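import Summits.CriticalPhenomena.CardyFormulaZ2.Theorems.CardyComplexConeSLESixFamiliesGiveCardySmoothMarkFamiliesPart1
import Literature.Probability.RandomPlanarGeometry.PlanarDomainsTopology
import HarnessLib

/-!
# drefute gen-7 — registered helper `smoothMark_part6` (STUB F, part 6/10): candidate proof

`smoothMark_part6` (registered 2026-08-16T05:16Z): far from the marks, whether a boundary site is at
least as close to `D.arc 0` as to `D.arc 1` is decided by the arc of ANY nearest frontier point `q`.
Proof: `dist (δx) q ≤ 2δ` (landed `smoothMark_part1`), so `q` is `≥ ρ - 2δ ≥ ρ/2` from both marks and the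
separation hypothesis applies to `q`; if `q ∈ D.arc 0` then `infDist (δx) (D.arc 1) ≥ c₀ - 2δ > 2δ ≥
infDist (δx) (D.arc 0)`, and symmetrically if `q ∈ D.arc 1 ∖ D.arc 0` (`frontier = D.arc 0 ∪ D.arc 1`).
Tightness remark for the prover: `4δ < c₀` may be weakened to `4δ ≤ c₀` only at the price of the strict
inequality in the second branch (not needed as stated).
-/

noncomputable section

open Set Metric
open Literature.Probability Literature.Probability.RandomPlanarGeometry
  Literature.Probability.LatticeModels

namespace Summit.CriticalPhenomena.CardyFormulaZ2.Cruxes.SLESixFamiliesGiveCardy.CollarTouchSandwich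
namespace DrefuteG7

/-- For a Dobrushin domain, `D.arc 0 ∪ D.arc 1` is the whole frontier. -/
theorem arc_zero_union_arc_one (D : DobrushinDomain) : D.arc 0 ∪ D.arc 1 = frontier D.carrier := by
  have h : (⋃ i, D.arc i) = frontier D.carrier := D.iUnion_arc_holds
  rw [← h]
  ext z
  simp only [mem_union, mem_iUnion, Fin.exists_fin_two]

/-- **`smoothMark_part6` verbatim (registered signature).** -/
theorem smoothMark_part6_proof : ∀ (D : DobrushinDomain) (δ ρ c₀ : ℝ), 0 ≤ δ → 4 * δ ≤ ρ → 4 * δ < c₀ → (∀ j : Fin 2, ∀ z ∈ D.arc j, ρ / 2 ≤ dist z (D.pt 0) → ρ / 2 ≤ dist z (D.pt 1) → c₀ ≤ Metric.infDist z (D.arc (j + 1))) → ∀ x : Site 2, x ∈ (⟨D.carrier, δ, ∅, ∅⟩ : DiscreteDobrushin).zdBoundary → ρ ≤ dist (meshPoint δ x) (D.pt 0) → ρ ≤ dist (meshPoint δ x) (D.pt 1) → ∀ q ∈ frontier D.carrier, dist (meshPoint δ x) q = Metric.infDist (meshPoint δ x) (frontier D.carrier) → (Metric.infDist (meshPoint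 δ x) (D.arc 0) ≤ Metric.infDist (meshPoint δ x) (D.arc 1) ↔ q ∈ D.arc 0) := by
  intro D δ ρ c₀ hδ hρ hc₀ hsep x hx hρ0 hρ1 q hq hdq
  set P := meshPoint δ x with hP
  have h1 : Metric.infDist P (frontier D.carrier) ≤ 2 * δ :=
    smoothMark_part1 (⟨D.carrier, δ, ∅, ∅⟩ : DiscreteDobrushin) D.isOpen hδ x hx
  have hd : dist P q ≤ 2 * δ := hdq ▸ h1
  -- `q` is far from both marks
  have hq0 : ρ / 2 ≤ dist q (D.pt 0) := by
    have := dist_triangle P q (D.pt 0)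
    linarith
  have hq1 : ρ / 2 ≤ dist q (D.pt 1) := by
    have := dist_triangle P q (D.pt 1)
    linarith
  have hq' : q ∈ D.arc 0 ∪ D.arc 1 := by rwa [arc_zero_union_arc_one]
  constructor
  · intro hle
    by_contra hq0'
    have hq1' : q ∈ D.arc 1 := hq'.resolve_left hq0'
    have hfar : c₀ ≤ Metric.infDist q (D.arc 0) := by
      simpa using hsep 1 q hq1' hq0 hq1
    have hA1 : Metric.infDist P (D.arc 1) ≤ dist P q := Metric.infDist_le_dist_of_mem hq1'
    have hA0 : Metric.infDist q (D.arc 0) ≤ Metric.infDist P (D.arc 0) + dist q P :=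
      Metric.infDist_le_infDist_add_dist
    rw [dist_comm q P] at hA0
    linarith
  · intro hq0'
    have hfar : c₀ ≤ Metric.infDist q (D.arc 1) := by
      simpa using hsep 0 q hq0' hq0 hq1
    have hA0 : Metric.infDist P (D.arc 0) ≤ dist P q := Metric.infDist_le_dist_of_mem hq0'
    have hA1 : Metric.infDist q (D.arc 1) ≤ Metric.infDist P (D.arc 1) + dist q P :=
      Metric.infDist_le_infDist_add_dist
    rw [dist_comm q P] at hA1
    linarith

end DrefuteG7
end Summit.CriticalPhenomena.CardyFormulaZ2.Cruxes.SLESixFamiliesGiveCardy.CollarTouchSandwich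

end
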